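import Summits.BirchSwinnertonDyer.BirchSwinnertonDyer.Theorems.PrintX11aMuCosetDoor
import Summits.BirchSwinnertonDyer.Rank1Residual.X11a.ChaRecords1
import Summits.BirchSwinnertonDyer.BirchSwinnertonDyer.Theorems.PrintX11aMuCosetRecords16
import Summits.BirchSwinnertonDyer.BirchSwinnertonDyer.Theorems.PrintX11aMuCosetRecords17
import HarnessLib

/-!
# Class X11a, NON-surjective leaf, HARD sub-locus (split at `p`, or `p ∣ ∏c·#Ш_an`): per-pair KERNEL
# μ-certificates through the Teichmüller-coset door — file 18 of 19: `15870o1`@3, `16698c1`@3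
# (cell `bsd-print-x11a`, seat p3 g2; `--supports stmt-BirchSwinnertonDyer-20613 --as helper`)

HONEST FRAMING (cells `b2b-bsdres` / `bsd-print-x11a`, verbatim): the goal is to DELETE the
COMBINATION-SHAPED residual classes of the Birch–Swinnerton-Dyer formula for ALL analytic-rank
`≤ 1` elliptic curves over `ℚ` — "full BSD formula for every rank `≤ 1` curve in class `C`"
assembled STRICTLY from published theorems — so that the rank-`≤ 1` remainder becomes exactly the
CONSTRUCTION-SHAPED classes, which are TYPED (missing-input `Prop`s), NOT attempted. This is not
"finishing BSD". PER PAIR (E1 currency): theorems only, no definition, no named fact; nothing is booked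
by this file and no class label changes (referee / planner). The CLASS-level children
`UpperNonSurjFive` (item 20614) / `UpperNonSurjThree` (item 20613) of crux `X11aNonSurjEulerHalf` stay
OPEN (Greenberg's μ-conjecture on the non-surjective X11a locus, barrier B3).

## What

For each pair below (the HARD sub-locus of the non-surjective X11a census: the unit-value door
`x11a_missingUpperBoundAt_of_not_surj_of_nonsplit_of_unit_value` does not apply), ty3's two-engine
μ-WITNESS record (`Literature/…/X11aPrintCertificates/RecordsLeafNonSurjMuPart1–2.lean`,
`RecordsThreeNonSurjMu.lean`: a level `n`, a Teichmüller coset `u·μ_{p−1} ⊂ (ℤ/pⁿ)^×` and the `p − 1`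
plus modular symbols `x(a/pⁿ)` on it, `x = ϖ·[·]⁺_f` normalised by `x(0) = L(E,1)/Ω_E`, engines S = eclib
and P = PARI twisted L-values, identical) is read IN THE KERNEL through p3's Teichmüller-coset door
(`Theorems/PrintX11aMuCosetCertificate.lean` + `PrintX11aMuCosetDoor.lean`): per pair

* `muAn<p>_m<label> : X11a.MuAnZeroAt W p` — for THE Mazur–Tate–Teitelbaum function of the reduction
  sign's kind SOME coefficient of `ϖ·L_p(E,T)` is a `p`-adic unit — from the DISPLAYED special value
  `L(E,1)/Ω_E` (`ht`) and the displayed `p − 1` symbol values (`hxs`), with the coset, the unit coset sum,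
  `‖L(E,1)/Ω_E‖_p ≤ 1`, minimality, `Mult`, `Irr` decided in the KERNEL, modulo Mazur 1978 Cor. 4.1
  (`hMz : mazur_not_dvd_maninConstant_of_odd`, `‖ϖ‖_p = 1`) — the per-pair instance of the registered stub
  `stub_muAnHard{Five,Three}` with NO assumed μ-claim;
* `mub<p>_m<label> : Typed.MissingUpperBoundAt W p` (crux-U currency) — `muAn` through the class-free
  rank-0 door `X11a.missingUpperBoundAt_of_muAnZeroAt_of_analyticRank_eq_zero[_of_nonsplit]` (K2
  μ-transfer without big image + rank-0 engine), modulo the TEN named facts of ty2's part 6 (+ Greenberg–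
  Stevens at a split pair) and the displayed `r_an = 0`, image bit;
* `bsdp<p>_m<label> : BSDp W p` — with the displayed unit `#Ш_an` (lower half free) and GZK.

Grammar of the kernel side = p4/p3's `X11a/ChaRecords*.lean` (Kraus minimality, `countPoints` Frobenius
witness, node-tangent non-split test, `integralModelInt`). beyond-print theorem: no.

References: [MazurTateTeitelbaum1986Invent] §I.10, §I.12–I.13; [Mazur1978] Cor. 4.1; [Kato2004Asterisque]
Thm. 12.4, §17.13; [Wuthrich2014] Cor. 18; [SteinWuthrich2013] Thm. 6.1, §3; [Miller2011LMS] Def. 1.1;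
[SilvermanAEC2009] VII.1, VII.5.1; [Kraus1989]; [Cremona2006]; cell files HOME/TY3-CERTIFICATE-RECORDS.md §7,
HOME/DOSSIER.md §26.2/§30, HOME/P3-EXCEPTIONAL-ZERO-ROAD.md §8.
-/

set_option autoImplicit false

noncomputable section

open scoped Classical MatrixGroups ModularForm

open CongruenceSubgroup WeierstrassCurve Literature.NumberTheory.EllipticCurves
  Literature.NumberTheory.EllipticCurves.ModularForms
  Literature.NumberTheory.EllipticCurves.Rank1Residual
  Literature.NumberTheory.EllipticCurves.Rank1Residual.Typed
  Literature.NumberTheory.EllipticCurves.Rank1Residual.X11RankOneCertificates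
  Literature.NumberTheory.EllipticCurves.Wuthrich2014
  Literature.NumberTheory.EllipticCurves.SteinWuthrich2013
  Literature.NumberTheory.EllipticCurves.Greenberg1999
  Literature.NumberTheory.EllipticCurves.Kato2004
  Summit.BirchSwinnertonDyer.BirchSwinnertonDyer.Rank1Residual.IntModel
  Summit.BirchSwinnertonDyer.BirchSwinnertonDyer.Rank1Residual.X11RankOne
  Summit.BirchSwinnertonDyer.Rank1Residual.Supersingular
  Summit.BirchSwinnertonDyer.Rank1Residual.X11b
  Summit.BirchSwinnertonDyer.Rank1Residual.X11a.ChaRecords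

namespace Summit.BirchSwinnertonDyer.Rank1Residual.X11a.MuCosetRecords

/-! Teichmüller coset lemmas `coset_<p>_<n>_<s₀>` reused BY NAME from the sibling files `PrintX11aMuCosetRecords16`, `PrintX11aMuCosetRecords17` (one FQN, one module). -/

/-! ### `15870o1 @ 3` (`N = 15870`, image `3Ns`, SPLIT multiplicative at `3`, `∏ c_ℓ = 36`, `#Ш_an = 1`, `L(E,1)/Ω_E = 9`;
μ-witness (ty3 `RecordsThreeNonSurjMu`, two engines): level `3`, `u = 1` (`s₀ = 0`), coset `{1, 26}` mod `27`, `x(1/27) = 13 / 2`, `x(26/27) = 13 / 2`, `Σ = 13`) -/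

/-- `15870o1 = [1, 0, 1, -887938, 320573588]` is globally minimal: `|Δ| = 2⁶ · 3³ · 5³ · 23⁹` (kernel) + Kraus.
[cite: SilvermanAEC2009, VII.1 Remark 1.1] [cite: Kraus1989, Prop. 1 and Prop. 2] -/
theorem isGloballyMinimal_m15870o1 : (⟨1, 0, 1, -887938, 320573588⟩ : WeierstrassCurve ℚ).IsGloballyMinimal :=
  isGloballyMinimal_of_krausCriterion₃_factored 1 0 1 (-887938) 320573588
    [(2, 6), (3, 3), (5, 3), (23, 9)] (by decide +kernel)
    (by intro qe hqe; simp only [List.mem_cons, List.not_mem_nil, or_false] at hqe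
        rcases hqe with rfl | rfl | rfl | rfl <;> norm_num)
    (by intro qe hqe; simp only [List.mem_cons, List.not_mem_nil, or_false] at hqe
        rcases hqe with rfl | rfl | rfl | rfl
        · exact Or.inl (by decide +kernel)
        · exact Or.inl (by decide +kernel)
        · exact Or.inl (by decide +kernel)
        · exact Or.inl (by decide +kernel))

/-- `#Ẽ(𝔽_7) = 8` for `15870o1` (`a_7 = 0`; `X² − a_7X + 7` root-free mod `3`: the Frobenius
irreducibility witness, kernel count `countPoints`). [folklore] -/
theorem card_m15870o1_7 :
    Nat.card (((⟨1, 0, 1, -887938, 320573588⟩ : WeierstrassCurve ℤ).map (Int.castRingHom (ZMod 7))).toAffine.Point) = 8 := by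
  have h := X11b.natCard_point_eq_countPoints 1 0 1 (-887938) 320573588 7 (by norm_num) (by decide +kernel)
  have h' : countPoints [1, 0, 1, -887938, 320573588] 7 = 8 := by decide +kernel
  exact_mod_cast h.trans h'

/-- The coset sum of the μ-witness table of `15870o1 @ 3` is `13` (kernel arithmetic on the displayed values). [folklore] -/
theorem sum_m15870o1 : (∑ b ∈ ({1, 26} : Finset (ZMod (3 ^ (2 + 1)))),
    (fun b ↦ if b = 1 then 13 / 2 else if b = 26 then 13 / 2 else 0) b : ℚ) = (13 : ℤ) / (1 : ℕ) := by
  decide +kernel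

/-- **`μ^an(E,3) = 0` for `15870o1` IN THE KERNEL from the displayed coset table** (`X11a.MuAnZeroAt W 3`: some
coefficient of `ϖ·L_3(E,T)`, THE split Mazur–Tate–Teitelbaum function, is a `3`-adic unit) = the per-pair instance of
the registered stub `stub_muAnHardThree`. DISPLAYED: `L(E,1)/Ω_E = 9` (`ht`), the 2 symbols `x(1/27) = 13 / 2`, `x(26/27) = 13 / 2`
(`hxs`, ty3's two-engine record; `x = ϖ·[·]⁺_f`, `x(0) = L(E,1)/Ω_E`). KERNEL: coset `{1, 26} = {b : b^2 = 4^{2·0}} ⊂ ℤ/27`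
(`coset_3_3_0`), unit coset sum `13` (`sum_m15870o1`), `Mult`, `Irr` (`card_m15870o1_7`). Modulo Mazur 1978 Cor. 4.1 (`hMz`).
PER PAIR; nothing booked. [cite: MazurTateTeitelbaum1986Invent, §I.10 and §I.12–I.13] [cite: Mazur1978, Cor. 4.1]
[cite: Cremona2006, Table 1 (Cremona label 15870o1)] -/
theorem muAn3_m15870o1 (hMz : mazur_not_dvd_maninConstant_of_odd)
    (W : WeierstrassCurve ℚ) (hW : W = ⟨1, 0, 1, -887938, 320573588⟩)
    (ht : W.entireLFunction 1 / (W.realPeriodRat : ℂ) = ((9 : ℚ) : ℂ))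
    (hxs : ∀ {N : ℕ} [NeZero N] (f : CuspForm (Gamma0 N) 2), IsNewformOf W f →
      ∀ (ϖ : ℚ), (ϖ : ℝ) * W.realPeriodRat = plusPeriod f →
        ϖ * ratPlusSymbol f (1 / 27) = 13 / 2 ∧
        ϖ * ratPlusSymbol f (26 / 27) = 13 / 2) :
    ∀ [W.IsElliptic] [W.IsGloballyMinimal] [Fact (Nat.Prime 3)], X11a.MuAnZeroAt W 3 := by
  intro _ _ _ N _ f₁ hf₁ ϖ₁ hϖ₁
  have hI' : integralModelInt W = ⟨1, 0, 1, -887938, 320573588⟩ := by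
    subst hW; exact integralModelInt_eq_of_map_eq _ (map_mk_int 1 0 1 (-887938) 320573588)
  have hmult : Mult W 3 :=
    hasMultiplicativeReductionAtPrime_of_intModel hI' 3 (by decide +kernel) (by decide +kernel)
  haveI : Fact (Nat.Prime 7) := ⟨by norm_num⟩
  have hirr : Irr W 3 :=
    hasIrreducibleModPGaloisRep_of_intModel_of_noroot (hp := ⟨by norm_num⟩) (hℓ := ⟨by norm_num⟩)
      hI' 3 7 (by norm_num) (by decide +kernel) card_m15870o1_7 (by decide)
  have hxs' : ∀ {N : ℕ} [NeZero N] (f : CuspForm (Gamma0 N) 2), IsNewformOf W f →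
      ∀ (ϖ : ℚ), (ϖ : ℝ) * W.realPeriodRat = plusPeriod f →
        ∀ b ∈ ({1, 26} : Finset (ZMod (3 ^ (2 + 1)))),
          ϖ * ratPlusSymbol f ((b.val : ℚ) / (3 : ℚ) ^ (2 + 1)) = (fun b ↦ if b = 1 then 13 / 2 else if b = 26 then 13 / 2 else 0) b := by
    intro N _ f hf ϖ hϖ b hb
    obtain ⟨h1, h2⟩ := hxs f hf ϖ hϖ
    simp only [Finset.mem_insert, Finset.mem_singleton] at hb
    rcases hb with rfl | rfl
    · rw [show (((1 : ZMod (3 ^ (2 + 1))).val : ℚ) / (3 : ℚ) ^ (2 + 1)) = 1 / 27 from by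
        rw [show (1 : ZMod (3 ^ (2 + 1))).val = 1 from by decide +kernel]; norm_num, h1]
      decide +kernel
    · rw [show (((26 : ZMod (3 ^ (2 + 1))).val : ℚ) / (3 : ℚ) ^ (2 + 1)) = 26 / 27 from by
        rw [show (26 : ZMod (3 ^ (2 + 1))).val = 26 from by decide +kernel]; norm_num, h2]
      decide +kernel
  have hunit : ‖((∑ b ∈ ({1, 26} : Finset (ZMod (3 ^ (2 + 1)))), (fun b ↦ if b = 1 then 13 / 2 else if b = 26 then 13 / 2 else 0) b : ℚ) : ℚ_[3])‖ = 1 := by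
    rw [sum_m15870o1]; exact MuCoset.norm_intCast_div_natCast_eq_one (by decide) (by decide)
  exact muAnZeroAt_of_cosetTable hMz (by decide) hmult hirr 9 ht (Padic.norm_rat_le_one (by decide))
    2 0 {1, 26} coset_3_3_0 (fun b ↦ if b = 1 then 13 / 2 else if b = 26 then 13 / 2 else 0) hxs' hunit f₁ hf₁ ϖ₁ hϖ₁

/-- **`15870o1 @ 3`: the UPPER half `ord_3 #Ш ≤ ord_3 #Ш_an`** (`Typed.MissingUpperBoundAt W 3` = crux `X11aNonSurjEulerHalf` /
child `UpperNonSurjThree` AT THIS PAIR) from the kernel μ-certificate `muAn3_m15870o1` through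
`X11a.missingUpperBoundAt_of_muAnZeroAt_of_analyticRank_eq_zero` (K2 μ-transfer without big image + rank-`0` engine):
modulo the TEN named facts of ty2's part 6 (SW13 Thm 6.1 ×2, GZK, modular parametrisation, Kato 12.4, Kato §17.13 ×3
[construction; flags `Kato-17.11-at-{nonsplit,split}-mult`, `Kato-p280-image-at-mult`], Greenberg 1.5, Wuthrich Cor 18),
Greenberg–Stevens at the pair (`hGS`, split `p`), Mazur Cor 4.1; DISPLAYED `r_an = 0` (`hr`), image bit `¬Surj` (`hnsj`, `3Ns`),
`ht`, `hxs`; KERNEL minimality, `Mult`, `Irr`. PER PAIR; nothing booked. [cite: Kato2004Asterisque, Thm. 12.4 (p. 221), §17.13 (pp. 279–280)]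
[cite: Wuthrich2014, Cor. 18 (p. 398)] [cite: SteinWuthrich2013, Thm. 6.1 (p. 20)] [cite: Mazur1978, Cor. 4.1] [cite: Cremona2006, Table 1 (Cremona label 15870o1)] -/
theorem mub3_m15870o1
    (hJs : thm61_splitMultiplicative) (hJn : thm61_nonsplitMultiplicative)
    (hGZK : rank_eq_analyticRank_of_analyticRank_le_one) (hpar : nonempty_modularParametrizationData)
    (h12 : Kato2004.thm12_4) (hns : Kato2004.exists_multDivisibilityInputs_nonsplit)
    (hsp : Kato2004.exists_multDivisibilityInputs_split) (h15 : thm15_isTorsion_multiplicative_rat)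
    (h18 : Wuthrich2014.corollary18_padicLFunction_mem_iwasawaAlgebra_multiplicative)
    (hfine : Kato2004.exists_multDivisibilityInputs_fine) (hMz : mazur_not_dvd_maninConstant_of_odd)
    (W : WeierstrassCurve ℚ) (hW : W = ⟨1, 0, 1, -887938, 320573588⟩)
    (hGS : ∀ [W.IsElliptic] [W.IsGloballyMinimal] [Fact (Nat.Prime 3)], greenberg_stevens (W := W) (p := 3))
    (hr : W.analyticRank = 0) (hnsj : ∀ [Fact (Nat.Prime 3)], ¬ Surj W 3)
    (ht : W.entireLFunction 1 / (W.realPeriodRat : ℂ) = ((9 : ℚ) : ℂ))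
    (hxs : ∀ {N : ℕ} [NeZero N] (f : CuspForm (Gamma0 N) 2), IsNewformOf W f →
      ∀ (ϖ : ℚ), (ϖ : ℝ) * W.realPeriodRat = plusPeriod f →
        ϖ * ratPlusSymbol f (1 / 27) = 13 / 2 ∧
        ϖ * ratPlusSymbol f (26 / 27) = 13 / 2) :
    MissingUpperBoundAt W 3 := by
  haveI : W.IsElliptic := by rw [hW]; exact X11b.isElliptic_of_discOf_ne_zero 1 0 1 (-887938) 320573588 (by decide +kernel)
  haveI : W.IsGloballyMinimal := by rw [hW]; exact isGloballyMinimal_m15870o1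
  haveI : Fact (Nat.Prime 3) := ⟨by norm_num⟩
  have hI' : integralModelInt W = ⟨1, 0, 1, -887938, 320573588⟩ := by
    subst hW; exact integralModelInt_eq_of_map_eq _ (map_mk_int 1 0 1 (-887938) 320573588)
  have hmult : Mult W 3 :=
    hasMultiplicativeReductionAtPrime_of_intModel hI' 3 (by decide +kernel) (by decide +kernel)
  haveI : Fact (Nat.Prime 7) := ⟨by norm_num⟩
  have hirr : Irr W 3 :=
    hasIrreducibleModPGaloisRep_of_intModel_of_noroot (hp := ⟨by norm_num⟩) (hℓ := ⟨by norm_num⟩)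
      hI' 3 7 (by norm_num) (by decide +kernel) card_m15870o1_7 (by decide)
  exact missingUpperBoundAt_of_muAnZeroAt_of_analyticRank_eq_zero W 3 hJs hJn hGZK hpar h12 hns hsp h15 h18 hfine hGS
    (by decide) hr hmult hirr hnsj (muAn3_m15870o1 hMz W hW ht hxs)

/-- **`BSD(E,3)` for `15870o1`** (`#Ш_an = 1`, a `3`-adic unit, displayed as `hq`/`hv`, so the lower half is free): the upper
half `mub3_m15870o1` + GZK. PER PAIR (E1 currency); modulo the ten facts + GS + Mazur + the displayed data; nothing booked;
the class-wide children U5/U3 stay open. [cite: Miller2011LMS, §1 and Def. 1.1] [cite: Cremona2006, Table 1 (Cremona label 15870o1)] -/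
theorem bsdp3_m15870o1
    (hJs : thm61_splitMultiplicative) (hJn : thm61_nonsplitMultiplicative)
    (hGZK : rank_eq_analyticRank_of_analyticRank_le_one) (hpar : nonempty_modularParametrizationData)
    (h12 : Kato2004.thm12_4) (hns : Kato2004.exists_multDivisibilityInputs_nonsplit)
    (hsp : Kato2004.exists_multDivisibilityInputs_split) (h15 : thm15_isTorsion_multiplicative_rat)
    (h18 : Wuthrich2014.corollary18_padicLFunction_mem_iwasawaAlgebra_multiplicative)
    (hfine : Kato2004.exists_multDivisibilityInputs_fine) (hMz : mazur_not_dvd_maninConstant_of_odd)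
    (W : WeierstrassCurve ℚ) (hW : W = ⟨1, 0, 1, -887938, 320573588⟩)
    (hGS : ∀ [W.IsElliptic] [W.IsGloballyMinimal] [Fact (Nat.Prime 3)], greenberg_stevens (W := W) (p := 3))
    (hr : W.analyticRank = 0) (hnsj : ∀ [Fact (Nat.Prime 3)], ¬ Surj W 3)
    (ht : W.entireLFunction 1 / (W.realPeriodRat : ℂ) = ((9 : ℚ) : ℂ))
    (hxs : ∀ {N : ℕ} [NeZero N] (f : CuspForm (Gamma0 N) 2), IsNewformOf W f →
      ∀ (ϖ : ℚ), (ϖ : ℝ) * W.realPeriodRat = plusPeriod f →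
        ϖ * ratPlusSymbol f (1 / 27) = 13 / 2 ∧
        ϖ * ratPlusSymbol f (26 / 27) = 13 / 2)
    {q : ℚ} (hq : shaAn W = (q : ℂ)) (hv : padicValRat 3 q = 0) : BSDp W 3 := by
  haveI : W.IsElliptic := by rw [hW]; exact X11b.isElliptic_of_discOf_ne_zero 1 0 1 (-887938) 320573588 (by decide +kernel)
  haveI : Fact (Nat.Prime 3) := ⟨by norm_num⟩
  exact bsdp_of_upper_of_unit_of_analyticRank_eq_zero W 3 hGZK hr
    (mub3_m15870o1 hJs hJn hGZK hpar h12 hns hsp h15 h18 hfine hMz W hW hGS hr hnsj ht hxs) hq hv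

/-! ### `16698c1 @ 3` (`N = 16698`, image `3Ns`, NON-split multiplicative at `3`, `∏ c_ℓ = 6`, `#Ш_an = 1`, `L(E,1)/Ω_E = 6`;
μ-witness (ty3 `RecordsThreeNonSurjMu`, two engines): level `2`, `u = 1` (`s₀ = 0`), coset `{1, 8}` mod `9`, `x(1/9) = 23 / 2`, `x(8/9) = 23 / 2`, `Σ = 23`) -/

/-- `16698c1 = [1, 1, 0, -4579610, 4239505428]` is globally minimal: `|Δ| = 2²¹ · 3³ · 11⁹ · 23³` (kernel) + Kraus.
[cite: SilvermanAEC2009, VII.1 Remark 1.1] [cite: Kraus1989, Prop. 1 and Prop. 2] -/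
theorem isGloballyMinimal_m16698c1 : (⟨1, 1, 0, -4579610, 4239505428⟩ : WeierstrassCurve ℚ).IsGloballyMinimal :=
  isGloballyMinimal_of_krausCriterion₃_factored 1 1 0 (-4579610) 4239505428
    [(2, 21), (3, 3), (11, 9), (23, 3)] (by decide +kernel)
    (by intro qe hqe; simp only [List.mem_cons, List.not_mem_nil, or_false] at hqe
        rcases hqe with rfl | rfl | rfl | rfl <;> norm_num)
    (by intro qe hqe; simp only [List.mem_cons, List.not_mem_nil, or_false] at hqe
        rcases hqe with rfl | rfl | rfl | rfl
        · exact Or.inr (Or.inl (by decide +kernel))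
        · exact Or.inl (by decide +kernel)
        · exact Or.inl (by decide +kernel)
        · exact Or.inl (by decide +kernel))

/-- `#Ẽ(𝔽_7) = 11` for `16698c1` (`a_7 = -3`; `X² − a_7X + 7` root-free mod `3`: the Frobenius
irreducibility witness, kernel count `countPoints`). [folklore] -/
theorem card_m16698c1_7 :
    Nat.card (((⟨1, 1, 0, -4579610, 4239505428⟩ : WeierstrassCurve ℤ).map (Int.castRingHom (ZMod 7))).toAffine.Point) = 11 := by
  have h := X11b.natCard_point_eq_countPoints 1 1 0 (-4579610) 4239505428 7 (by norm_num) (by decide +kernel)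
  have h' : countPoints [1, 1, 0, -4579610, 4239505428] 7 = 11 := by decide +kernel
  exact_mod_cast h.trans h'

/-- The node-tangent quadratic of `16698c1` mod `3` is root-free: NON-split multiplicative reduction at `3`
(kernel decision; Silverman *AEC* VII.5.1(b)). [cite: SilvermanAEC2009, VII.5 Prop. 5.1(b)] -/
theorem nodal_m16698c1 :
    letI E₀ : WeierstrassCurve ℤ := ⟨1, 1, 0, -4579610, 4239505428⟩
    ∀ t : ZMod 3, (E₀.c₄ : ZMod 3) * t ^ 2 + (E₀.a₁ * E₀.c₄ : ZMod 3) * t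
      - (54 * E₀.b₆ - 3 * E₀.b₂ * E₀.b₄ + E₀.a₂ * E₀.c₄ : ZMod 3) ≠ 0 := by
  decide +kernel

/-- The coset sum of the μ-witness table of `16698c1 @ 3` is `23` (kernel arithmetic on the displayed values). [folklore] -/
theorem sum_m16698c1 : (∑ b ∈ ({1, 8} : Finset (ZMod (3 ^ (1 + 1)))),
    (fun b ↦ if b = 1 then 23 / 2 else if b = 8 then 23 / 2 else 0) b : ℚ) = (23 : ℤ) / (1 : ℕ) := by
  decide +kernel

/-- **`μ^an(E,3) = 0` for `16698c1` IN THE KERNEL from the displayed coset table** (`X11a.MuAnZeroAt W 3`: some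
coefficient of `ϖ·L_3(E,T)`, THE non-split Mazur–Tate–Teitelbaum function, is a `3`-adic unit) = the per-pair instance of
the registered stub `stub_muAnHardThree`. DISPLAYED: `L(E,1)/Ω_E = 6` (`ht`), the 2 symbols `x(1/9) = 23 / 2`, `x(8/9) = 23 / 2`
(`hxs`, ty3's two-engine record; `x = ϖ·[·]⁺_f`, `x(0) = L(E,1)/Ω_E`). KERNEL: coset `{1, 8} = {b : b^2 = 4^{2·0}} ⊂ ℤ/9`
(`coset_3_2_0`), unit coset sum `23` (`sum_m16698c1`), `Mult`, `Irr` (`card_m16698c1_7`). Modulo Mazur 1978 Cor. 4.1 (`hMz`).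
PER PAIR; nothing booked. [cite: MazurTateTeitelbaum1986Invent, §I.10 and §I.12–I.13] [cite: Mazur1978, Cor. 4.1]
[cite: Cremona2006, Table 1 (Cremona label 16698c1)] -/
theorem muAn3_m16698c1 (hMz : mazur_not_dvd_maninConstant_of_odd)
    (W : WeierstrassCurve ℚ) (hW : W = ⟨1, 1, 0, -4579610, 4239505428⟩)
    (ht : W.entireLFunction 1 / (W.realPeriodRat : ℂ) = ((6 : ℚ) : ℂ))
    (hxs : ∀ {N : ℕ} [NeZero N] (f : CuspForm (Gamma0 N) 2), IsNewformOf W f →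
      ∀ (ϖ : ℚ), (ϖ : ℝ) * W.realPeriodRat = plusPeriod f →
        ϖ * ratPlusSymbol f (1 / 9) = 23 / 2 ∧
        ϖ * ratPlusSymbol f (8 / 9) = 23 / 2) :
    ∀ [W.IsElliptic] [W.IsGloballyMinimal] [Fact (Nat.Prime 3)], X11a.MuAnZeroAt W 3 := by
  intro _ _ _ N _ f₁ hf₁ ϖ₁ hϖ₁
  have hI' : integralModelInt W = ⟨1, 1, 0, -4579610, 4239505428⟩ := by
    subst hW; exact integralModelInt_eq_of_map_eq _ (map_mk_int 1 1 0 (-4579610) 4239505428)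
  have hmult : Mult W 3 :=
    hasMultiplicativeReductionAtPrime_of_intModel hI' 3 (by decide +kernel) (by decide +kernel)
  haveI : Fact (Nat.Prime 7) := ⟨by norm_num⟩
  have hirr : Irr W 3 :=
    hasIrreducibleModPGaloisRep_of_intModel_of_noroot (hp := ⟨by norm_num⟩) (hℓ := ⟨by norm_num⟩)
      hI' 3 7 (by norm_num) (by decide +kernel) card_m16698c1_7 (by decide)
  have hxs' : ∀ {N : ℕ} [NeZero N] (f : CuspForm (Gamma0 N) 2), IsNewformOf W f →
      ∀ (ϖ : ℚ), (ϖ : ℝ) * W.realPeriodRat = plusPeriod f →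
        ∀ b ∈ ({1, 8} : Finset (ZMod (3 ^ (1 + 1)))),
          ϖ * ratPlusSymbol f ((b.val : ℚ) / (3 : ℚ) ^ (1 + 1)) = (fun b ↦ if b = 1 then 23 / 2 else if b = 8 then 23 / 2 else 0) b := by
    intro N _ f hf ϖ hϖ b hb
    obtain ⟨h1, h2⟩ := hxs f hf ϖ hϖ
    simp only [Finset.mem_insert, Finset.mem_singleton] at hb
    rcases hb with rfl | rfl
    · rw [show (((1 : ZMod (3 ^ (1 + 1))).val : ℚ) / (3 : ℚ) ^ (1 + 1)) = 1 / 9 from by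
        rw [show (1 : ZMod (3 ^ (1 + 1))).val = 1 from by decide +kernel]; norm_num, h1]
      decide +kernel
    · rw [show (((8 : ZMod (3 ^ (1 + 1))).val : ℚ) / (3 : ℚ) ^ (1 + 1)) = 8 / 9 from by
        rw [show (8 : ZMod (3 ^ (1 + 1))).val = 8 from by decide +kernel]; norm_num, h2]
      decide +kernel
  have hunit : ‖((∑ b ∈ ({1, 8} : Finset (ZMod (3 ^ (1 + 1)))), (fun b ↦ if b = 1 then 23 / 2 else if b = 8 then 23 / 2 else 0) b : ℚ) : ℚ_[3])‖ = 1 := by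
    rw [sum_m16698c1]; exact MuCoset.norm_intCast_div_natCast_eq_one (by decide) (by decide)
  exact muAnZeroAt_of_cosetTable hMz (by decide) hmult hirr 6 ht (Padic.norm_rat_le_one (by decide))
    1 0 {1, 8} coset_3_2_0 (fun b ↦ if b = 1 then 23 / 2 else if b = 8 then 23 / 2 else 0) hxs' hunit f₁ hf₁ ϖ₁ hϖ₁

/-- **`16698c1 @ 3`: the UPPER half `ord_3 #Ш ≤ ord_3 #Ш_an`** (`Typed.MissingUpperBoundAt W 3` = crux `X11aNonSurjEulerHalf` /
child `UpperNonSurjThree` AT THIS PAIR) from the kernel μ-certificate `muAn3_m16698c1` through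
`X11a.missingUpperBoundAt_of_muAnZeroAt_of_analyticRank_eq_zero_of_nonsplit` (K2 μ-transfer without big image + rank-`0` engine):
modulo the TEN named facts of ty2's part 6 (SW13 Thm 6.1 ×2, GZK, modular parametrisation, Kato 12.4, Kato §17.13 ×3
[construction; flags `Kato-17.11-at-{nonsplit,split}-mult`, `Kato-p280-image-at-mult`], Greenberg 1.5, Wuthrich Cor 18),
(no Greenberg–Stevens binder: non-split, `RankZeroHeightFree.greenberg_stevens_of_not_split`), Mazur Cor 4.1; DISPLAYED `r_an = 0` (`hr`), image bit `¬Surj` (`hnsj`, `3Ns`),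
`ht`, `hxs`; KERNEL minimality, `Mult`, `Irr`, non-split (`nodal_m16698c1`). PER PAIR; nothing booked. [cite: Kato2004Asterisque, Thm. 12.4 (p. 221), §17.13 (pp. 279–280)]
[cite: Wuthrich2014, Cor. 18 (p. 398)] [cite: SteinWuthrich2013, Thm. 6.1 (p. 20)] [cite: Mazur1978, Cor. 4.1] [cite: Cremona2006, Table 1 (Cremona label 16698c1)] -/
theorem mub3_m16698c1
    (hJs : thm61_splitMultiplicative) (hJn : thm61_nonsplitMultiplicative)
    (hGZK : rank_eq_analyticRank_of_analyticRank_le_one) (hpar : nonempty_modularParametrizationData)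
    (h12 : Kato2004.thm12_4) (hns : Kato2004.exists_multDivisibilityInputs_nonsplit)
    (hsp : Kato2004.exists_multDivisibilityInputs_split) (h15 : thm15_isTorsion_multiplicative_rat)
    (h18 : Wuthrich2014.corollary18_padicLFunction_mem_iwasawaAlgebra_multiplicative)
    (hfine : Kato2004.exists_multDivisibilityInputs_fine) (hMz : mazur_not_dvd_maninConstant_of_odd)
    (W : WeierstrassCurve ℚ) (hW : W = ⟨1, 1, 0, -4579610, 4239505428⟩)
    (hr : W.analyticRank = 0) (hnsj : ∀ [Fact (Nat.Prime 3)], ¬ Surj W 3)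
    (ht : W.entireLFunction 1 / (W.realPeriodRat : ℂ) = ((6 : ℚ) : ℂ))
    (hxs : ∀ {N : ℕ} [NeZero N] (f : CuspForm (Gamma0 N) 2), IsNewformOf W f →
      ∀ (ϖ : ℚ), (ϖ : ℝ) * W.realPeriodRat = plusPeriod f →
        ϖ * ratPlusSymbol f (1 / 9) = 23 / 2 ∧
        ϖ * ratPlusSymbol f (8 / 9) = 23 / 2) :
    MissingUpperBoundAt W 3 := by
  haveI : W.IsElliptic := by rw [hW]; exact X11b.isElliptic_of_discOf_ne_zero 1 1 0 (-4579610) 4239505428 (by decide +kernel)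
  haveI : W.IsGloballyMinimal := by rw [hW]; exact isGloballyMinimal_m16698c1
  haveI : Fact (Nat.Prime 3) := ⟨by norm_num⟩
  have hI' : integralModelInt W = ⟨1, 1, 0, -4579610, 4239505428⟩ := by
    subst hW; exact integralModelInt_eq_of_map_eq _ (map_mk_int 1 1 0 (-4579610) 4239505428)
  have hmult : Mult W 3 :=
    hasMultiplicativeReductionAtPrime_of_intModel hI' 3 (by decide +kernel) (by decide +kernel)
  haveI : Fact (Nat.Prime 7) := ⟨by norm_num⟩
  have hirr : Irr W 3 :=
    hasIrreducibleModPGaloisRep_of_intModel_of_noroot (hp := ⟨by norm_num⟩) (hℓ := ⟨by norm_num⟩)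
      hI' 3 7 (by norm_num) (by decide +kernel) card_m16698c1_7 (by decide)
  have hnsp : ¬ W.HasSplitMultiplicativeReductionAtPrime 3 :=
    not_hasSplitMultiplicativeReductionAtPrime_of_intModel_of_noroot hI' 3 (by decide +kernel)
      (by decide +kernel) nodal_m16698c1
  exact missingUpperBoundAt_of_muAnZeroAt_of_analyticRank_eq_zero_of_nonsplit W 3 hJs hJn hGZK hpar h12 hns hsp h15 h18 hfine
    (by decide) hr hmult hirr hnsj hnsp (muAn3_m16698c1 hMz W hW ht hxs)

/-- **`BSD(E,3)` for `16698c1`** (`#Ш_an = 1`, a `3`-adic unit, displayed as `hq`/`hv`, so the lower half is free): the upper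
half `mub3_m16698c1` + GZK. PER PAIR (E1 currency); modulo the ten facts + Mazur + the displayed data; nothing booked;
the class-wide children U5/U3 stay open. [cite: Miller2011LMS, §1 and Def. 1.1] [cite: Cremona2006, Table 1 (Cremona label 16698c1)] -/
theorem bsdp3_m16698c1
    (hJs : thm61_splitMultiplicative) (hJn : thm61_nonsplitMultiplicative)
    (hGZK : rank_eq_analyticRank_of_analyticRank_le_one) (hpar : nonempty_modularParametrizationData)
    (h12 : Kato2004.thm12_4) (hns : Kato2004.exists_multDivisibilityInputs_nonsplit)
    (hsp : Kato2004.exists_multDivisibilityInputs_split) (h15 : thm15_isTorsion_multiplicative_rat)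
    (h18 : Wuthrich2014.corollary18_padicLFunction_mem_iwasawaAlgebra_multiplicative)
    (hfine : Kato2004.exists_multDivisibilityInputs_fine) (hMz : mazur_not_dvd_maninConstant_of_odd)
    (W : WeierstrassCurve ℚ) (hW : W = ⟨1, 1, 0, -4579610, 4239505428⟩)
    (hr : W.analyticRank = 0) (hnsj : ∀ [Fact (Nat.Prime 3)], ¬ Surj W 3)
    (ht : W.entireLFunction 1 / (W.realPeriodRat : ℂ) = ((6 : ℚ) : ℂ))
    (hxs : ∀ {N : ℕ} [NeZero N] (f : CuspForm (Gamma0 N) 2), IsNewformOf W f →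
      ∀ (ϖ : ℚ), (ϖ : ℝ) * W.realPeriodRat = plusPeriod f →
        ϖ * ratPlusSymbol f (1 / 9) = 23 / 2 ∧
        ϖ * ratPlusSymbol f (8 / 9) = 23 / 2)
    {q : ℚ} (hq : shaAn W = (q : ℂ)) (hv : padicValRat 3 q = 0) : BSDp W 3 := by
  haveI : W.IsElliptic := by rw [hW]; exact X11b.isElliptic_of_discOf_ne_zero 1 1 0 (-4579610) 4239505428 (by decide +kernel)
  haveI : Fact (Nat.Prime 3) := ⟨by norm_num⟩
  exact bsdp_of_upper_of_unit_of_analyticRank_eq_zero W 3 hGZK hr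
    (mub3_m16698c1 hJs hJn hGZK hpar h12 hns hsp h15 h18 hfine hMz W hW hr hnsj ht hxs) hq hv

end Summit.BirchSwinnertonDyer.Rank1Residual.X11a.MuCosetRecords

end
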